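import Mathlib.Analysis.SpecialFunctions.Pow.Real
import HarnessLib

/-!
# Route `RoughParitySectors`, crux `OddSectorShareNonlinear` (stmt-Parity-15628), line `registered`
# (birth): exactness of the route's split — the two real-arithmetic squeezes

`--supports stmt-Parity-15628` file (part 1 of 3 of the exactness package; see
`RoughParitySectorsOddSectorShareNonlinearExactness.lean` for the statement and the route-level
corollaries).  Pure real arithmetic, PROVED: at one `x`, write `L = (log x)^k`, `c₁` = prime cell,
`co` = all-odd sector, `R` = rough count, `m = C(f)/∏deg fᵢ`, `Q = 2^k`, `Ak = (U e^{−γ}/2)^k` (so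
`m·e^{−kγ}·U^k = m·Q·Ak`) and `τ` for the common tolerance of the inputs.

* `share_arith`: prime-cell band `|c₁L − mx| ≤ τx` + rough-count band `|RL − x·mQAk| ≤ τ·x·mQAk` +
  parity balance `|Q·co − R| ≤ τR` ⟹ share `|c₁·Ak − co| ≤ (2τ(1+3m)/m)·co` (`τ ≤ 1/4`);
* `balance_arith`: prime-cell band + rough-count band + share `|c₁·Ak − co| ≤ τ·co` ⟹ balance
  `|Q·co − R| ≤ (2τ(3m+1)/m)·R` (`τ ≤ min(1/4, m/4)`).
-/

namespace Summit.Parity.BatemanHorn.Cruxes.OddSectorShareNonlinear.Birth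

namespace Exactness

/-! ### §1 Two real-arithmetic squeezes

Notation of this section: at one `x`, `L = (log x)^k`, `c₁` the prime cell, `co` the all-odd sector,
`R` the rough count, `m = C(f)/∏deg fᵢ`, `Q = 2^k`, `Ak = (U e^{−γ}/2)^k` (so that
`m·e^{−kγ}·U^k = m·Q·Ak`), `τ` the common tolerance of the three inputs. -/

/-- **Share squeeze.** From `|c₁L − mx| ≤ τx` (prime cell), `|RL − x·mQAk| ≤ τ·x·mQAk` (rough count)
and `|Q·co − R| ≤ τR` (parity balance) with `0 ≤ τ ≤ 1/4`:
`|c₁·Ak − co| ≤ (2τ(1+3m)/m)·co`. [folklore] -/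
theorem share_arith {c₁ co R L x m Ak Q τ : ℝ} (hL : 0 < L) (hx : 0 < x) (hm : 0 < m)
    (hAk : 0 < Ak) (hQ : 0 < Q) (hτ0 : 0 ≤ τ) (hτ : τ ≤ 1 / 4)
    (h1 : |c₁ * L - m * x| ≤ τ * x)
    (h2 : |R * L - x * (m * (Q * Ak))| ≤ τ * (x * (m * (Q * Ak))))
    (h3 : |Q * co - R| ≤ τ * R) :
    |c₁ * Ak - co| ≤ 2 * τ * (1 + 3 * m) / m * co := by
  -- `Z = x m Ak` is kept expanded so that `linarith` sees the monomials
  have hZ0 : 0 < x * m * Ak := by positivity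
  have hQZ : x * (m * (Q * Ak)) = Q * (x * m * Ak) := by ring
  rw [hQZ] at h2
  obtain ⟨h1a, h1b⟩ := abs_le.1 h1
  obtain ⟨h2a, h2b⟩ := abs_le.1 h2
  obtain ⟨h3a, h3b⟩ := abs_le.1 h3
  have hQZ0 : 0 < Q * (x * m * Ak) := mul_pos hQ hZ0
  have hτQZ : τ * (Q * (x * m * Ak)) ≤ 1 / 4 * (Q * (x * m * Ak)) :=
    mul_le_mul_of_nonneg_right hτ hQZ0.le
  -- `R ≥ 0`
  have hR0 : 0 ≤ R := le_of_mul_le_mul_right (by linarith : 0 * L ≤ R * L) hL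
  -- `Q co L ∈ [(1-τ) R L, (1+τ) R L]`
  have hco_lo : (1 - τ) * (R * L) ≤ Q * co * L := by
    have := mul_le_mul_of_nonneg_right (show (1 - τ) * R ≤ Q * co by linarith) hL.le
    linarith
  have hco_hi : Q * co * L ≤ (1 + τ) * (R * L) := by
    have := mul_le_mul_of_nonneg_right (show Q * co ≤ (1 + τ) * R by linarith) hL.le
    linarith
  -- hence `co L ∈ [(1-τ)² Z, (1+τ)² Z]` (chain through `(1 ∓ τ) R L`, then divide by `Q`)
  have hcoL_lo : (1 - τ) ^ 2 * (x * m * Ak) ≤ co * L := by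
    have h' : (1 - τ) * ((1 - τ) * (Q * (x * m * Ak))) ≤ (1 - τ) * (R * L) :=
      mul_le_mul_of_nonneg_left (by linarith) (by linarith)
    exact le_of_mul_le_mul_left (by linarith : Q * ((1 - τ) ^ 2 * (x * m * Ak)) ≤ Q * (co * L)) hQ
  have hcoL_hi : co * L ≤ (1 + τ) ^ 2 * (x * m * Ak) := by
    have h' : (1 + τ) * (R * L) ≤ (1 + τ) * ((1 + τ) * (Q * (x * m * Ak))) :=
      mul_le_mul_of_nonneg_left (by linarith) (by linarith)
    exact le_of_mul_le_mul_left (by linarith : Q * (co * L) ≤ Q * ((1 + τ) ^ 2 * (x * m * Ak))) hQ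
  -- `c₁ Ak L ∈ [Z - τ x Ak, Z + τ x Ak]`
  have hc_lo : x * m * Ak - τ * x * Ak ≤ c₁ * Ak * L := by
    have := mul_le_mul_of_nonneg_right (show m * x - τ * x ≤ c₁ * L by linarith) hAk.le
    linarith
  have hc_hi : c₁ * Ak * L ≤ x * m * Ak + τ * x * Ak := by
    have := mul_le_mul_of_nonneg_right (show c₁ * L ≤ m * x + τ * x by linarith) hAk.le
    linarith
  -- signs and sizes of the small monomials
  have hs1 : 0 ≤ τ ^ 2 * (x * m * Ak) := by positivity
  have hs2 : 0 ≤ τ * (x * m * Ak) := by positivity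
  have hs3 : τ ^ 2 * (x * m * Ak) ≤ τ * (x * m * Ak) := by
    have hτ2 : τ ^ 2 ≤ τ := by nlinarith
    exact mul_le_mul_of_nonneg_right hτ2 hZ0.le
  have hs4 : 2 * τ * (x * m * Ak) ≤ 1 / 2 * (x * m * Ak) := by
    have : 2 * τ ≤ 1 / 2 := by linarith
    exact mul_le_mul_of_nonneg_right this hZ0.le
  -- the two one-sided bounds, `× L`
  have hup : (c₁ * Ak - co) * L ≤ τ * (1 + 3 * m) * (x * Ak) := by linarith
  have hdn : -(τ * (1 + 3 * m) * (x * Ak)) ≤ (c₁ * Ak - co) * L := by linarith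
  have habs : |c₁ * Ak - co| * L ≤ τ * (1 + 3 * m) * (x * Ak) := by
    rw [← abs_of_pos hL, ← abs_mul]
    exact abs_le.2 ⟨hdn, hup⟩
  -- `Z ≤ 2 co L`
  have hZco : x * m * Ak ≤ 2 * (co * L) := by linarith
  -- conclude: multiply the goal by `L m > 0`
  rw [div_mul_eq_mul_div, le_div_iff₀ hm]
  have key : |c₁ * Ak - co| * m * L ≤ 2 * τ * (1 + 3 * m) * co * L :=
    calc |c₁ * Ak - co| * m * L = |c₁ * Ak - co| * L * m := by ring
      _ ≤ τ * (1 + 3 * m) * (x * Ak) * m := mul_le_mul_of_nonneg_right habs hm.le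
      _ = τ * (1 + 3 * m) * (x * m * Ak) := by ring
      _ ≤ τ * (1 + 3 * m) * (2 * (co * L)) := mul_le_mul_of_nonneg_left hZco (by positivity)
      _ = 2 * τ * (1 + 3 * m) * co * L := by ring
  exact le_of_mul_le_mul_right key hL

/-- **Balance squeeze.** From `|c₁L − mx| ≤ τx` (prime cell), `|RL − x·mQAk| ≤ τ·x·mQAk` (rough
count) and `|c₁·Ak − co| ≤ τ·co` (share) with `0 ≤ τ ≤ min(1/4, m/4)`:
`|Q·co − R| ≤ (2τ(3m+1)/m)·R`. [folklore] -/
theorem balance_arith {c₁ co R L x m Ak Q τ : ℝ} (hL : 0 < L) (hx : 0 < x) (hm : 0 < m)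
    (hAk : 0 < Ak) (hQ : 0 < Q) (hτ0 : 0 ≤ τ) (hτ : τ ≤ 1 / 4) (hτm : τ ≤ m / 4)
    (h1 : |c₁ * L - m * x| ≤ τ * x)
    (h2 : |R * L - x * (m * (Q * Ak))| ≤ τ * (x * (m * (Q * Ak))))
    (h4 : |c₁ * Ak - co| ≤ τ * co) :
    |Q * co - R| ≤ 2 * τ * (3 * m + 1) / m * R := by
  have hZ0 : 0 < x * m * Ak := by positivity
  have hQZ : x * (m * (Q * Ak)) = Q * (x * m * Ak) := by ring
  rw [hQZ] at h2
  obtain ⟨h1a, h1b⟩ := abs_le.1 h1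
  obtain ⟨h2a, h2b⟩ := abs_le.1 h2
  obtain ⟨h4a, h4b⟩ := abs_le.1 h4
  have hQZ0 : 0 < Q * (x * m * Ak) := mul_pos hQ hZ0
  have hτQZ : τ * (Q * (x * m * Ak)) ≤ 1 / 4 * (Q * (x * m * Ak)) :=
    mul_le_mul_of_nonneg_right hτ hQZ0.le
  -- `co ≥ 0`: otherwise `τ co ≤ 0` forces `c₁ Ak = co < 0`, contradicting `c₁ L ≥ (m − τ) x > 0`
  have hmτx : 0 < (m - τ) * x := mul_pos (by linarith) hx
  have hc1L : 0 < c₁ * L := by nlinarith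
  have hc1 : 0 < c₁ := by
    by_contra h'
    have : c₁ * L ≤ 0 := mul_nonpos_of_nonpos_of_nonneg (le_of_not_gt h') hL.le
    linarith
  have hco0 : 0 ≤ co := by
    by_contra hc
    have hc' : co < 0 := lt_of_not_ge hc
    have : τ * co ≤ 0 := mul_nonpos_of_nonneg_of_nonpos hτ0 hc'.le
    have hca : 0 < c₁ * Ak := mul_pos hc1 hAk
    linarith [abs_nonneg (c₁ * Ak - co)]
  -- (i) `Q Ak c₁ L` versus `W = Q co L`
  have hQL0 : 0 ≤ Q * L := by positivity
  have hi_lo : (co - τ * co) * (Q * L) ≤ c₁ * Ak * (Q * L) :=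
    mul_le_mul_of_nonneg_right (by linarith) hQL0
  have hi_hi : c₁ * Ak * (Q * L) ≤ (co + τ * co) * (Q * L) :=
    mul_le_mul_of_nonneg_right (by linarith) hQL0
  -- (ii) `Q Ak c₁ L` versus `Q Z`
  have hQA0 : 0 ≤ Q * Ak := by positivity
  have hii_lo : (m * x - τ * x) * (Q * Ak) ≤ c₁ * L * (Q * Ak) :=
    mul_le_mul_of_nonneg_right (by linarith) hQA0
  have hii_hi : c₁ * L * (Q * Ak) ≤ (m * x + τ * x) * (Q * Ak) :=
    mul_le_mul_of_nonneg_right (by linarith) hQA0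
  -- `τ x Q Ak ≤ (1/4) Q Z` (from `τ ≤ m/4`)
  have hxQA : τ * (x * (Q * Ak)) ≤ 1 / 4 * (Q * (x * m * Ak)) := by
    have := mul_le_mul_of_nonneg_right hτm (by positivity : (0 : ℝ) ≤ x * (Q * Ak))
    linarith
  -- signs
  have hs1 : 0 ≤ τ * (Q * co * L) := by positivity
  have hs2 : 0 ≤ τ * (x * (Q * Ak)) := by positivity
  -- (iii) `W ≤ 2 Q Z`, then `τ W ≤ 2 τ Q Z`
  have hτW' : τ * (Q * co * L) ≤ 1 / 4 * (Q * co * L) :=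
    mul_le_mul_of_nonneg_right hτ (by positivity)
  have hW2 : Q * co * L ≤ 2 * (Q * (x * m * Ak)) := by linarith
  have hτW : τ * (Q * co * L) ≤ τ * (2 * (Q * (x * m * Ak))) := mul_le_mul_of_nonneg_left hW2 hτ0
  -- (iv) `R L ≥ (1-τ) Q Z ≥ (1/2) Q Z`
  have hRL : Q * (x * m * Ak) ≤ 2 * (R * L) := by linarith
  -- (v) the two one-sided bounds for `(Q co − R)·L·m`
  have hxQA' : τ * (x * (Q * Ak)) * m = τ * (Q * (x * m * Ak)) := by ring
  have hup : (Q * co - R) * L * m ≤ 2 * τ * (3 * m + 1) * R * L := by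
    have h' : (Q * co - R) * L ≤ 3 * τ * (Q * (x * m * Ak)) + τ * (x * (Q * Ak)) := by linarith
    have h'' := mul_le_mul_of_nonneg_right h' hm.le
    have h3 : (3 * τ * (Q * (x * m * Ak)) + τ * (x * (Q * Ak))) * m =
        τ * (3 * m + 1) * (Q * (x * m * Ak)) := by rw [add_mul, hxQA']; ring
    rw [h3] at h''
    calc (Q * co - R) * L * m ≤ τ * (3 * m + 1) * (Q * (x * m * Ak)) := h''
      _ ≤ τ * (3 * m + 1) * (2 * (R * L)) := mul_le_mul_of_nonneg_left hRL (by positivity)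
      _ = 2 * τ * (3 * m + 1) * R * L := by ring
  have hdn : (R - Q * co) * L * m ≤ 2 * τ * (3 * m + 1) * R * L := by
    have h' : (R - Q * co) * L ≤ 3 * τ * (Q * (x * m * Ak)) + τ * (x * (Q * Ak)) := by linarith
    have h'' := mul_le_mul_of_nonneg_right h' hm.le
    have h3 : (3 * τ * (Q * (x * m * Ak)) + τ * (x * (Q * Ak))) * m =
        τ * (3 * m + 1) * (Q * (x * m * Ak)) := by rw [add_mul, hxQA']; ring
    rw [h3] at h''
    calc (R - Q * co) * L * m ≤ τ * (3 * m + 1) * (Q * (x * m * Ak)) := h''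
      _ ≤ τ * (3 * m + 1) * (2 * (R * L)) := mul_le_mul_of_nonneg_left hRL (by positivity)
      _ = 2 * τ * (3 * m + 1) * R * L := by ring
  have habs : |Q * co - R| * (L * m) ≤ 2 * τ * (3 * m + 1) * R * L := by
    rw [← abs_of_pos (mul_pos hL hm), ← abs_mul]
    refine abs_le.2 ⟨?_, ?_⟩
    · have : (Q * co - R) * (L * m) = -((R - Q * co) * L * m) := by ring
      rw [this]; linarith
    · have : (Q * co - R) * (L * m) = (Q * co - R) * L * m := by ring
      rw [this]; exact hup
  rw [div_mul_eq_mul_div, le_div_iff₀ hm]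
  have key : |Q * co - R| * m * L ≤ 2 * τ * (3 * m + 1) * R * L :=
    calc |Q * co - R| * m * L = |Q * co - R| * (L * m) := by ring
      _ ≤ _ := habs
  exact le_of_mul_le_mul_right key hL

end Exactness

end Summit.Parity.BatemanHorn.Cruxes.OddSectorShareNonlinear.Birth
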